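import Summits.Ventures.PercRepro.RankLevelSetColoopDeviceRows

/-!
# PercRepro — THE CELL `(22, 9)` MODULO ITS COLOOP-FREE PIECES (p8 g13, S3)

The device splits every `e`-free core `M` of rank `22`, corank `9`, by the number `k` of its coloops: `k ≥ 7` is the trivial
row (`c025_core_six_twentytwo_nine_of_coloops`); `k = 0` is the coloop-free cell; `1 ≤ k ≤ 6` is the `k`-times scaled
coloop-free cell at rank `22 − k` (`Φ(22, 6)/2^k · #U_{M₀} ≤ #Y_{M₀}`), because every window of the device contains
`(6, 22 − k)` (`midCount_le_midShift`) and `Σ_i C(k, i) = 2^k`. So `c025_core_six_twentytwo_nine_of` states the cell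
`(22, 9)` modulo exactly the seven coloop-free statements the counting method prices at `0.971 / 0.891 / 0.819 / 0.763 /
0.751 / 0.746 / 0.845` (S3 §3z, §3z⁗) — no every-core cell anywhere.

Axioms: standard.
-/

open Set
open scoped Matroid

namespace PercRepro

namespace Matroid

variable {α : Type} {M : _root_.Matroid α} [M.Finite]

/-- Every window of the device contains the honest window: `#Y(p₀, q) ≤ #Y^{(i)}(p₀ + k, q)` for `i ≤ k`. -/
theorem midCount_le_midShift {i k : ℕ} (hik : i ≤ k) (p₀ q : ℕ) :
    midCount M p₀ q ≤ midShift M i (p₀ + k) q := by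
  unfold midCount midShift
  apply Set.ncard_le_ncard
  · intro A hA
    obtain ⟨hAE, h1, h2⟩ := hA
    refine ⟨hAE, lt_of_lt_of_le h1 le_self_add, ?_⟩
    calc M.eRk A + (i : ℕ∞) < (p₀ : ℕ∞) + (i : ℕ∞) := WithTop.add_lt_add_right (ENat.coe_ne_top i) h2
      _ ≤ (p₀ : ℕ∞) + (k : ℕ∞) := by gcongr
      _ = ((p₀ + k : ℕ) : ℕ∞) := by push_cast; rfl
  · exact M.ground_finite.finite_subsets.subset fun X hX => hX.1

end Matroid

namespace ThmN

open Matroid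

variable {α : Type}

/-- **The scaled form of the device**: `K` a finite set of coloops (`k = |K| ≥ 1`), `r(M) = p`, `q + 1 < p`; the `k`-times
scaled inequality for `M ＼ K` — `Φ(p, q+1)/2^k · #U_{M ＼ K}(p − k, q+1) ≤ #Y_{M ＼ K}(p − k, q+1)` — gives `RLS M p (q+1)`. -/
theorem RLS_of_coloops_device_scaled (M : Matroid α) [M.Finite] (K : Finset α) (hK : ∀ e ∈ K, M.IsColoop e)
    {p q : ℕ} (hqp : q + 1 < p) (hR : M.eRank = (p : ℕ∞)) (hk : K.card ≤ p)
    (h : phiK p (q + 1) / 2 ^ K.card * (Matroid.topCount (M ＼ (K : Set α)) (p - K.card) (q + 1) : ℚ) ≤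
      (Matroid.midCount (M ＼ (K : Set α)) (p - K.card) (q + 1) : ℚ)) :
    RLS M p (q + 1) := by
  apply RLS_of_coloops_device M K hK hqp hR
  have hwin : ∀ i ∈ Finset.range (K.card + 1),
      ((K.card.choose i : ℕ) : ℚ) * (Matroid.midCount (M ＼ (K : Set α)) (p - K.card) (q + 1) : ℚ) ≤
        ((K.card.choose i : ℕ) : ℚ) * (Matroid.midShift (M ＼ (K : Set α)) i p (q + 1) : ℚ) := by
    intro i hi
    rw [Finset.mem_range] at hi
    have h1 := midCount_le_midShift (M := M ＼ (K : Set α)) (i := i) (k := K.card) (by omega) (p - K.card) (q + 1)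
    rw [Nat.sub_add_cancel hk] at h1
    exact mul_le_mul_of_nonneg_left (Nat.cast_le.mpr h1) (Nat.cast_nonneg _)
  have hsum := Finset.sum_le_sum hwin
  rw [← Finset.sum_mul, ← Nat.cast_sum, Nat.sum_range_choose] at hsum
  have h2 : phiK p (q + 1) * (Matroid.topCount (M ＼ (K : Set α)) (p - K.card) (q + 1) : ℚ) ≤
      ((2 ^ K.card : ℕ) : ℚ) * (Matroid.midCount (M ＼ (K : Set α)) (p - K.card) (q + 1) : ℚ) := by
    have hpos : (0 : ℚ) < 2 ^ K.card := by positivity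
    rw [div_mul_eq_mul_div, div_le_iff₀ hpos] at h
    push_cast
    linarith
  exact h2.trans hsum

/-- **THE CELL `(22, 9)` MODULO ITS COLOOP-FREE PIECES**: `h0` = the coloop-free cell `(22, 9)`, `hs k` = the `k`-times scaled
coloop-free cell at rank `22 − k` (`1 ≤ k ≤ 6`); the rows `k ≥ 7` are `c025_core_six_twentytwo_nine_of_coloops`. -/
theorem c025_core_six_twentytwo_nine_of (M : Matroid α) [M.Finite]
    (hR : M.eRank = (22 : ℕ∞)) (hn : M.E.ncard = 22 + 9)
    (hfree : ∀ e ∈ M.E, ∃ A ⊆ M.E \ {e}, e ∉ M.closure A ∧ e ∉ M.closure ((M.E \ {e}) \ A))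
    (h0 : ∀ N : Matroid α, ∀ [N.Finite], (∀ e ∈ N.E, ¬ N.IsColoop e) → N.eRank = (22 : ℕ∞) → N.E.ncard = 22 + 9 →
      (∀ e ∈ N.E, ∃ A ⊆ N.E \ {e}, e ∉ N.closure A ∧ e ∉ N.closure ((N.E \ {e}) \ A)) → RLS N 22 6)
    (hs : ∀ k : ℕ, 1 ≤ k → k ≤ 6 → ∀ N : Matroid α, ∀ [N.Finite], (∀ e ∈ N.E, ¬ N.IsColoop e) →
      N.eRank = ((22 - k : ℕ) : ℕ∞) → N.E.ncard = 22 - k + 9 →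
      (∀ e ∈ N.E, ∃ A ⊆ N.E \ {e}, e ∉ N.closure A ∧ e ∉ N.closure ((N.E \ {e}) \ A)) →
      phiK 22 6 / 2 ^ k * (Matroid.topCount N (22 - k) 6 : ℚ) ≤ (Matroid.midCount N (22 - k) 6 : ℚ)) :
    RLS M 22 6 := by
  classical
  have hfin : M.coloops.Finite := M.ground_finite.subset (Matroid.coloops_subset_ground M)
  by_cases h7 : 7 ≤ M.coloops.ncard
  · exact c025_core_six_twentytwo_nine_of_coloops M hR hn hfree h7
  by_cases h0' : M.coloops.ncard = 0
  · -- no coloop at all: the coloop-free cell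
    have hcf : ∀ e ∈ M.E, ¬ M.IsColoop e := by
      intro e _ he
      have : e ∈ M.coloops := he
      rw [(Set.ncard_eq_zero hfin).1 h0'] at this
      exact this
    exact h0 M hcf hR hn hfree
  -- `1 ≤ k ≤ 6`: the scaled coloop-free cell at rank `22 − k` on `M ＼ K`
  set K : Finset α := hfin.toFinset with hKdef
  have hKset : (K : Set α) = M.coloops := by rw [hKdef, Set.Finite.coe_toFinset]
  have hK : ∀ e ∈ K, M.IsColoop e := fun e he => by
    rw [hKdef, Set.Finite.mem_toFinset] at he
    exact he
  have hcard : K.card = M.coloops.ncard := by rw [hKdef, Set.ncard_eq_toFinset_card _ hfin]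
  have hR' : M.eRank = ((22 : ℕ) : ℕ∞) := hR
  obtain ⟨hn0, hR0, hfree0, hk⟩ := delete_coloops_core_data M K hK hR' hn hfree
  have hcf0 : ∀ e ∈ (M ＼ (K : Set α)).E, ¬ (M ＼ (K : Set α)).IsColoop e := by
    intro e _
    rw [hKset]
    exact not_isColoop_delete_coloops M e
  have h := hs K.card (by omega) (by omega) (M ＼ (K : Set α)) hcf0 hR0 hn0 hfree0
  exact RLS_of_coloops_device_scaled M K hK (q := 5) (by norm_num) hR' hk h

end ThmN

end PercRepro
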